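import Summits.CriticalPhenomena.PercolationContinuityZ3.Theorems.Transplant.PlanarSkeletonFrmQuasiDefs
import HarnessLib

/-!
# The interface plumbing of `PlanarSkeletonFrmQuasi` (the (N3-b) quasi-step carrier, p507026): vertices over every chart point, (κ″) AT EVERY VERTEX, connectedness,
# `p_c < 1` and a.s. uniqueness with NO connectedness hypothesis — row (c1) of WAVE-Q-MANIFEST v0.4, the twin of «PlanarSkeletonFrmFrom1» §1 under
# `Skelφ.QStepsN` (exact-footprint quasi-steps) and (κ″) (cylinders joined inside their `W`-fattening)

builds on p205010 (kernel theorem, internal audit signed; external expert review pending) — nothing in this file uses p205010; no node / statement / `@[conjecture]`; nothing about the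
(not yet worded) quasi-step node is claimed.  Lane `prim-bschramm`, seat `prim-bschramm-gen-1` (gen 4; GEN pen; row (c1) BY NAME from the design owner p3-g29, bus 2026-08-27
06:53Z).  Helper file (`--supports stmt-CriticalPhenomena-4575 --as helper`); def-free.
WHAT CHANGES w.r.t. «PlanarSkeletonFrmFrom1» (p3 g26): (ι) single steps ↦ `Φ.qstep : Skelφ.QStepsN G φ M`, so 'a vertex over every chart point' comes from
`Skelφ.QStepsN.exists_mem_graphBall_eq` (radius `M·‖Δ‖₁`); (κ′) ↦ (κ″), so the frame transport gives, at EVERY vertex `v` and every half-width `ℓ ≥ ℓ₀`, 'two vertices of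
`cyl v ℓ` are joined inside `cyl v (ℓ + W)`' (`cyl_reach_at`: the frame `α` with `α t = v` carries `cyl t ·` onto `cyl v ·`, as the induced-graph isomorphism `induceIso α`);
connectedness needs no slab chain any more: every vertex lies in a large cylinder about a base vertex and is joined to it inside the fattened one (`graph_connected`); hence
`p_c < 1` at every vertex with no hypothesis (`criticalProb_lt_one`, through the Defs' step-free `criticalProb_lt_one_frmQuasi`), countability, and Burton–Keane uniqueness off
exponential growth (`numInfiniteClusters_le_one`).
* §1 `exists_mem_graphBall_φ_eq`, `exists_φ_eq_add_single`; §2 `mem_cyl_frame_iff`, **`cyl_reach_at`**; §3 **`graph_connected`**, `countable`, **`criticalProb_lt_one`**,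
  **`numInfiniteClusters_le_one`**.
[cite: KozmaNitzan2024, §4 p. 15 (boxes and their translates), p. 16 (Lemma 8), p. 26 ((29))] [cite: BenjaminiSchramm1996, Thm. 1; §2] [cite: LyonsPeres2016, Thm. 7.6]
[cite: BurtonKeane1989, Thm. 2]
-/

noncomputable section

namespace Summit.CriticalPhenomena.PercolationContinuityZ3.Theorems.Transplant

open MeasureTheory Filter Literature.Probability.Percolation Literature.Probability.LatticeModels SimpleGraph
open Literature.Probability.Percolation.GrimmettMarstrand1990 (induceIso)
open Literature.Barriers.CriticalPhenomena (IsQuasiTransitive IsGraphAmenable HasExponentialGrowth graphBall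
  hasExponentialGrowth_of_not_isGraphAmenable BurtonKeane1989_atMostOneInfiniteCluster_holds countable_of_connected_of_locallyFinite)
open scoped Classical

namespace PlanarSkeletonFrmQuasi

variable {V : Type} {G : SimpleGraph V} [G.LocallyFinite]

/-! ## §1 Vertices over every chart point -/

/-- **A vertex over every chart point, within graph distance `M·‖z − φ v‖₁`** (iterated quasi-steps). [cite: KozmaNitzan2024, §4 p. 26 ((29))] -/
theorem exists_mem_graphBall_φ_eq (Φ : PlanarSkeletonFrmQuasi G) (v : V) (z : Site 2) :
    ∃ w, w ∈ graphBall G v (Φ.M * ((z 0 - Φ.φ v 0).natAbs + (z 1 - Φ.φ v 1).natAbs)) ∧ Φ.φ w = z :=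
  Skelφ.QStepsN.exists_mem_graphBall_eq Φ.qstep v z

/-- **A vertex over every point of a coordinate line** through `φ(v)` (twin of `PlanarSkeletonFrmFrom.exists_φ_eq_add_single`). [cite: KozmaNitzan2024, §4 p. 26 ((29))] -/
theorem exists_φ_eq_add_single (Φ : PlanarSkeletonFrmQuasi G) (v : V) (i : Fin 2) (x : ℤ) : ∃ w, Φ.φ w = Φ.φ v + Pi.single i x := by
  obtain ⟨w, -, hw⟩ := Φ.exists_mem_graphBall_φ_eq v (Φ.φ v + Pi.single i x)
  exact ⟨w, hw⟩

/-! ## §2 (κ″) at every vertex -/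

/-- A frame `α` (`α t = v`, translating `φ` by `φ v − φ t`) carries `cyl t ℓ` onto `cyl v ℓ`. [folklore] -/
theorem mem_cyl_frame_iff (Φ : PlanarSkeletonFrmQuasi G) {t v : V} {α : G ≃g G} (hα : ∀ w, Φ.φ (α w) = Φ.φ w + (Φ.φ v - Φ.φ t)) (ℓ : ℕ) (w : V) :
    w ∈ Φ.cyl t ℓ ↔ α w ∈ Φ.cyl v ℓ := by
  have h : Φ.φ w + (Φ.φ v - Φ.φ t) - Φ.φ v = Φ.φ w - Φ.φ t := by abel
  simp only [cyl, Set.mem_setOf_eq, hα w, h]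

/-- **(κ″) AT EVERY VERTEX**: for every vertex `v` and half-width `ℓ ≥ ℓ₀`, any two vertices of `cyl v ℓ` are joined inside `cyl v (ℓ + W)` (frame transport of the field
`cyl_reach` from the type of `v`). [cite: KozmaNitzan2024, §4 p. 15 (boxes and their translates)] -/
theorem cyl_reach_at (Φ : PlanarSkeletonFrmQuasi G) (v : V) {ℓ : ℕ} (hℓ : Φ.ℓ₀ ≤ ℓ) {u u' : V} (hu : u ∈ Φ.cyl v ℓ) (hu' : u' ∈ Φ.cyl v ℓ) :
    ∃ (h₁ : u ∈ Φ.cyl v (ℓ + Φ.W)) (h₂ : u' ∈ Φ.cyl v (ℓ + Φ.W)), (G.induce (Φ.cyl v (ℓ + Φ.W))).Reachable ⟨u, h₁⟩ ⟨u', h₂⟩ := by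
  obtain ⟨t, ht, α, hαt, hα⟩ := Φ.frame v
  -- pull `u, u'` back to the base cylinder
  have hpu : α.symm u ∈ Φ.cyl t ℓ := by rw [Φ.mem_cyl_frame_iff hα, RelIso.apply_symm_apply]; exact hu
  have hpu' : α.symm u' ∈ Φ.cyl t ℓ := by rw [Φ.mem_cyl_frame_iff hα, RelIso.apply_symm_apply]; exact hu'
  obtain ⟨k₁, k₂, hr⟩ := Φ.cyl_reach' ht hℓ hpu hpu'
  -- push the joining walk forward along the induced isomorphism
  set e : G.induce (Φ.cyl t (ℓ + Φ.W)) ≃g G.induce (Φ.cyl v (ℓ + Φ.W)) := induceIso α (fun w => Φ.mem_cyl_frame_iff hα (ℓ + Φ.W) w) with he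
  have h₁ : u ∈ Φ.cyl v (ℓ + Φ.W) := by have := (Φ.mem_cyl_frame_iff hα (ℓ + Φ.W) (α.symm u)).1 k₁; rwa [RelIso.apply_symm_apply] at this
  have h₂ : u' ∈ Φ.cyl v (ℓ + Φ.W) := by have := (Φ.mem_cyl_frame_iff hα (ℓ + Φ.W) (α.symm u')).1 k₂; rwa [RelIso.apply_symm_apply] at this
  refine ⟨h₁, h₂, ?_⟩
  have hmap := hr.map e.toHom
  have e₁ : e.toHom ⟨α.symm u, k₁⟩ = ⟨u, h₁⟩ := Subtype.ext (RelIso.apply_symm_apply α u)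
  have e₂ : e.toHom ⟨α.symm u', k₂⟩ = ⟨u', h₂⟩ := Subtype.ext (RelIso.apply_symm_apply α u')
  rwa [e₁, e₂] at hmap

/-! ## §3 Connectedness, `p_c < 1`, uniqueness -/

/-- **The graph of a `PlanarSkeletonFrmQuasi` is connected** (every vertex lies in a large cylinder about the type of `t` and is joined to it inside the fattened cylinder;
no slab chain needed). [folklore] -/
theorem graph_connected (Φ : PlanarSkeletonFrmQuasi G) (t : V) : G.Connected := by
  obtain ⟨t₀, ht₀, -⟩ := Φ.frame t
  refine (connected_iff _).2 ⟨?_, ⟨t₀⟩⟩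
  suffices h : ∀ a, G.Reachable a t₀ from fun a b => (h a).trans (h b).symm
  intro a
  set ℓ : ℕ := (Φ.φ a 0 - Φ.φ t₀ 0).natAbs + (Φ.φ a 1 - Φ.φ t₀ 1).natAbs + Φ.ℓ₀ with hℓ
  have ha : a ∈ Φ.cyl t₀ ℓ := by
    show Φ.φ a - Φ.φ t₀ ∈ box 2 ℓ
    rw [mem_box]
    intro i
    simp only [Pi.sub_apply]
    have ha0 := le_abs_self (Φ.φ a 0 - Φ.φ t₀ 0); have ha0' := neg_abs_le (Φ.φ a 0 - Φ.φ t₀ 0)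
    have ha1 := le_abs_self (Φ.φ a 1 - Φ.φ t₀ 1); have ha1' := neg_abs_le (Φ.φ a 1 - Φ.φ t₀ 1)
    have hb0 := abs_nonneg (Φ.φ a 0 - Φ.φ t₀ 0); have hb1 := abs_nonneg (Φ.φ a 1 - Φ.φ t₀ 1)
    fin_cases i <;> constructor <;> simp only [hℓ] <;> push_cast <;> linarith
  have ht : t₀ ∈ Φ.cyl t₀ ℓ := by
    show Φ.φ t₀ - Φ.φ t₀ ∈ box 2 ℓ
    rw [sub_self]; exact zero_mem_box 2 ℓ
  obtain ⟨ha', ht', hr⟩ := Φ.cyl_reach' ht₀ (show Φ.ℓ₀ ≤ ℓ by omega) ha ht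
  exact hr.map (Embedding.induce _).toHom

/-- The vertex set is countable. [folklore] -/
theorem countable (Φ : PlanarSkeletonFrmQuasi G) (t : V) : Countable V := countable_of_connected_of_locallyFinite G (Φ.graph_connected t) t

/-- **`p_c < 1` at EVERY vertex**, no connectedness hypothesis (step-free: frames + quasi-steps, through `criticalProb_lt_one_frmQuasi`). [cite: BenjaminiSchramm1996, Thm. 1; §2] -/
theorem criticalProb_lt_one (Φ : PlanarSkeletonFrmQuasi G) (t : V) : criticalProb G t < 1 :=
  Φ.criticalProb_lt_one_frmQuasi (Φ.graph_connected t) t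

/-- **A.s. uniqueness at every density** off exponential growth (connected by §3, quasi-transitive by the frames, amenable by the growth hypothesis; Burton–Keane).
[cite: LyonsPeres2016, Thm. 7.6] [cite: BurtonKeane1989, Thm. 2] -/
theorem numInfiniteClusters_le_one (Φ : PlanarSkeletonFrmQuasi G) (hG : ¬ HasExponentialGrowth G) {t : V} (ht : t ∈ Φ.types) (p : unitInterval) :
    ∀ᵐ ω ∂(bondPercolation G p), numInfiniteClusters ω ≤ 1 := by
  have hq : IsQuasiTransitive G := Φ.isQuasiTransitive_frmQuasi
  have ha : IsGraphAmenable G := by_contra fun hna => hG (hasExponentialGrowth_of_not_isGraphAmenable G hq hna)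
  have _ := ht
  exact BurtonKeane1989_atMostOneInfiniteCluster_holds G (Φ.graph_connected t) hq ha p

end PlanarSkeletonFrmQuasi

end Summit.CriticalPhenomena.PercolationContinuityZ3.Theorems.Transplant

end
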